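import Summits.BirchSwinnertonDyer.BirchSwinnertonDyer.Theorems.EisensteinPrimesBSDpOnCellCCtlLocFinV
import Summits.BirchSwinnertonDyer.BirchSwinnertonDyer.Theorems.KatoDescentPotSupersingularTowerTorsionVanishing
import Summits.BirchSwinnertonDyer.Rank1Residual.X11b.LocalTorsionMultiplicative
import Summits.BirchSwinnertonDyer.Rank1Residual.X12.O11.LocalKernelFiniteAtThreeDischarge
import Literature.NumberTheory.EllipticCurves.PAdicBSDSplitMultiplicativeProofs
import Literature.NumberTheory.EllipticCurves.Kato2004.LocPKummerLog
import HarnessLib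

/-!
# Route `ErratumRoadFive`, crux `EulerHalfNotRamNoInertSetAtFive` (stmt-BirchSwinnertonDyer-19715), line `kato_Fframe`
# (registered r5.2 `Cruxes/EulerHalfNotRamNoInertSetAtFive/Lines/kato_Fframe_r5.lean` cf457b9468bcf978), stub S1Λ
# `stub_katoLambdaLogBoundTamagawa` — HELPER R-fin: **`W(ℚ_{p,∞})[p^∞]` is FINITE at a MULTIPLICATIVE prime `p ≥ 3`
# along the cyclotomic `ℤ_p`-tower** (the `hfin` binder of Kato's `𝐇²_Γ ⊇ X₀` comparison, of the typed F1′ and of P1′,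
# VERBATIM: `Finite (FixedPoints.addSubgroup ↥(κ.kerSubgroup ⊓ GreenbergSelmer.decomp v) (W.geomPrimaryTorsion p))`)

LEAD seat `bsd-line-er5-p1` (g8), `--supports stmt-BirchSwinnertonDyer-19715`; theorems only (no definition, no named fact,
no `sorry`); nothing here closes 19715 or a registered stub. HONEST FRAMING: this discharges ONE hypothesis inside the
proof burden of S1Λ (the cell pen's note 2026-08-30T05:47:14Z: «R-fin = `hfin` at MULTIPLICATIVE odd `p` for the cyclotomic
tower is not yet a tree theorem … it sits INSIDE S1Λ's proof burden as typed»); no summit statement is proved; BSD is proved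
for no curve.

## What and why

Kato's comparison `X₀(W/ℚ_∞) ↪ 𝐇²_Γ(T_pW)` (tree named fact `Kato2004.exists_iwasawaH2Data_fineSelmerDual_embedding`,
(14.9.1) + (17.13.1)), its sequel `…_count`, the typed length inequality F1′ (Kato Thm. 12.5 (4) in fine-Selmer form) and the
landed rank-one descent P1′ (`Theorems/ErratumRoadFiveKatoFframeFineDescentRankOne.lean`,
`…_of_lengthAt_le_of_rankOne_of_embedding_fact`) all carry the hypothesis that the `p`-power torsion of `W` rational over
the completion `ℚ_{p,∞}` of the cyclotomic tower at the place above `p` is FINITE — the group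
`(W(ℚ̄)[p^∞])^{ker κ ⊓ D_v}`; it is exactly Kato's (12.5.1)-guard (`𝐇²_{Γ,loc}` pseudo-null). The tree proves it at a
good ORDINARY `p` (`finite_fixedPoints_kerSubgroup_inf_decomp_of_ordinary`), NAMES it at a potentially good `p` (Imai 1975),
and proves the VANISHING form whenever `W(ℚ_p)[p] = 0` (`TowerTorsionVanishing`). At a MULTIPLICATIVE `p` — the regime
of S1Λ (`p ≥ 5`, `p ∥ N`) — it was open in the tree. This file proves it for every odd multiplicative `p`:

* §1 `finite_fixedPoints_kerSubgroup_inf_decomp_of_nonsplit` — NON-SPLIT multiplicative `p ≥ 3`, ANY `ℤ_p`-extension: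
  `W(ℚ_p)[p] = 0` (`X11b.LocalTorsion.localTorsion_eq_zero_of_nonsplit`: `[E(ℚ_p):E₁(ℚ_p)] = c_p·#Ẽ_ns(𝔽_p) = c_p(p+1)`,
  `c_p ∈ {1,2}`), so the fixed points VANISH by the pro-`p` descent of `TowerTorsionVanishing` (in fact `= ⊥`).
* §2 `localTowerTorsionFiniteAt_of_split_of_isCyclotomic` — SPLIT multiplicative `p ≥ 3`, `κ` CYCLOTOMIC: the pattern of
  `CtlLoc.localTowerTorsionFiniteAt_of_trivQuotLine` run over `K = ℚ`: the Tate line `C ≅ μ_{p^∞}` of Tate's uniformisation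
  `Φ : ℚ̄_vˣ → E(ℚ̄_v)` (tree THEOREM `TateCurve.Silverman1994_thmV53_tateUniformisation_holds`), `D_v` acting trivially on
  `E[p^∞]/C` (`CtlLoc.tateDatum_smul_sub_mem_of_equivariant`), `#C[p] ≤ p` and points of every order
  (`SchneiderFreeAdditiveX3.tateDatum_lineClauses`), `E[p^∞]^{D_v} ↪ E(ℚ_v)[p^∞]` finite
  (`X12.O11.finite_primaryComponent_point_adicCompletion`, `X11b.AcSelmer.natCard_fixedPoints_decomp_le_natCard_primaryComponent`),
  and the MOVER: an element `τ` of the inertia group of `ℚ_v` with cyclotomic character `χ_p(τ) = −1`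
  (`adicCompletion_rat_exists_mem_absInertia_cyclotomicCharacter_eq`; `ℚ_p(μ_{p^∞})/ℚ_p` totally ramified) — a TORSION unit, so
  `res τ ∈ ker κ` for the cyclotomic `κ` (`ZpExtension.IsCyclotomic`: `ker κ = χ_p⁻¹(μ(ℤ_p))`), while `τ` acts on a point `c ∈ C`
  of order `p` as `−1` (`SchneiderFreeAdditiveX3.smul_eq_sign_mul_cyclotomic_smul_of_mem_tateDatum`), i.e. MOVES it (`p` odd).
  [Equivalently: `ℚ_p(q^{1/p})/ℚ_p` is not Galois, so no `p`-th root of the Tate period lies in the abelian `ℚ_{p,∞}`.]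
* §3 `finite_fixedPoints_kerSubgroup_inf_decomp_of_split` (the `hfin` shape at a split `p`) and the assembly
  **`finite_fixedPoints_kerSubgroup_inf_decomp_of_multiplicative`** — `p ≥ 3` multiplicative (either sign), `κ` cyclotomic,
  `primesEquiv v = p`: `Finite (FixedPoints.addSubgroup ↥(κ.kerSubgroup ⊓ decomp v) (W.geomPrimaryTorsion p))`.

Scope notes. `p = 2` is excluded (at `p = 2` the mover `−1` is trivial on `C[2]`; S1Λ has `p ≥ 5`). The non-split case
holds for EVERY `ℤ_p`-extension; the split case is stated for the cyclotomic one (for an arbitrary `κ` it is false exactly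
when `ker κ ⊓ D_v` fixes `μ_{p^∞}` AND the Tate period becomes a `p`-power up the local tower — not needed here).

References: [GreenbergLNM1716] §3, Lemma 3.3 and its proof (p. 87), PDF pp. 90–92 (the Tate line at `v ∣ p` multiplicative);
[GreenbergVatsal2000] §2 pp. 14–15 (`C ≅ μ_{p^∞}`, `D ≅ ℚ_p/ℤ_p` trivial); [SilvermanATAEC1994] Ch. V Thm. 3.1, Thm. 5.3;
[SerreLocalFields1979] Ch. IV §4 Prop. 17 (`χ_p(I_{ℚ_p}) = ℤ_pˣ`); [Kato2004Asterisque] §12.2 (12.2.3) (p. 220), Thm. 12.5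
(3)–(4) with (12.5.1) (p. 222); [JetchevSkinnerWan2017] §3.3 Prop. 3.3.4 Case 3(b) (finiteness of `T^∨_{P_v}` at `p ∥ N`);
[SilvermanAEC2009] VII.2.1, VII.3.1, VII.6.1 (`E(ℚ_p)[p] = 0` at non-split `p ≥ 3`).
-/

-- the summit and its single problem are both named `BirchSwinnertonDyer` (registry layout D-0017)
set_option linter.dupNamespace false
set_option autoImplicit false

noncomputable section

open scoped Classical NumberField
open Field IsDedekindDomain NumberField WeierstrassCurve
open Literature.NumberTheory.EllipticCurves Literature.NumberTheory.EllipticCurves.GreenbergSelmer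
open Literature.NumberTheory.GaloisRepresentations
open Summit.BirchSwinnertonDyer.Rank1Residual
open Summit.BirchSwinnertonDyer.Rank1Residual.X2.GreenbergVatsalTateDatum
open Summit.BirchSwinnertonDyer.Rank1Residual.X2.GreenbergVatsalTateDatumSign
open Summit.BirchSwinnertonDyer.BirchSwinnertonDyer.Theorems.SchneiderFreeControlAtoms
open Summit.BirchSwinnertonDyer.BirchSwinnertonDyer.Theorems.SchneiderFreeAdditiveX3

namespace Summit.BirchSwinnertonDyer.BirchSwinnertonDyer.Theorems.ErratumRoadFiveKatoFframeLocalTowerTorsionFiniteMult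

variable (W : WeierstrassCurve ℚ) [W.IsElliptic] [W.IsGloballyMinimal] (p : ℕ) [hp : Fact p.Prime]

/-! ## §1 Non-split multiplicative `p ≥ 3`: the fixed points vanish (any `ℤ_p`-extension) -/

/-- **Non-split multiplicative `p ≥ 3`: `(W(ℚ̄)[p^∞])^{ker κ ⊓ D_v} = ⊥` for EVERY `ℤ_p`-extension `κ` of `ℚ`**
(`W(ℚ_p)[p] = 0` at a non-split multiplicative odd prime, then the pro-`p` descent of `TowerTorsionVanishing`).
[cite: SilvermanAEC2009, VII.2.1, VII.3.1 and Thm. VII.6.1] [cite: GreenbergLNM1716, §3 Lemma 3.1 and proof of Prop. 4.8] -/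
theorem fixedPoints_kerSubgroup_inf_decomp_eq_bot_of_nonsplit (hp3 : 3 ≤ p)
    (hmult : W.HasMultiplicativeReductionAtPrime p) (hns : ¬ W.HasSplitMultiplicativeReductionAtPrime p)
    (κ : ZpExtension ℚ p) (v : HeightOneSpectrum (𝓞 ℚ))
    (hv : ((Rat.HeightOneSpectrum.primesEquiv v : Nat.Primes) : ℕ) = p) :
    FixedPoints.addSubgroup ↥(κ.kerSubgroup ⊓ decomp v) (W.geomPrimaryTorsion p) = ⊥ :=
  TowerTorsionVanishing.fixedPoints_kerSubgroup_inf_decomp_eq_bot_of_noPTorsionPadic W p κ v hv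
    (X11b.LocalTorsion.localTorsion_eq_zero_of_nonsplit W p hp3 hmult hns)

/-- **Non-split multiplicative `p ≥ 3`: `W(ℚ_{∞,w})[p^∞] = (W(ℚ̄)[p^∞])^{ker κ ⊓ D_v}` is FINITE for EVERY
`ℤ_p`-extension `κ` of `ℚ`** — the `hfin` binder of `Kato2004.exists_iwasawaH2Data_fineSelmerDual_embedding` VERBATIM.
[cite: Kato2004Asterisque, §12.2 (12.2.3) (p. 220) and Thm. 12.5 (3) with (12.5.1) (p. 222)] [cite: SilvermanAEC2009, Thm. VII.6.1] -/
theorem finite_fixedPoints_kerSubgroup_inf_decomp_of_nonsplit (hp3 : 3 ≤ p)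
    (hmult : W.HasMultiplicativeReductionAtPrime p) (hns : ¬ W.HasSplitMultiplicativeReductionAtPrime p)
    (κ : ZpExtension ℚ p) (v : HeightOneSpectrum (𝓞 ℚ))
    (hv : ((Rat.HeightOneSpectrum.primesEquiv v : Nat.Primes) : ℕ) = p) :
    Finite (FixedPoints.addSubgroup ↥(κ.kerSubgroup ⊓ decomp v) (W.geomPrimaryTorsion p)) :=
  TowerTorsionVanishing.finite_fixedPoints_kerSubgroup_inf_decomp_of_noPTorsionPadic W p κ v hv
    (X11b.LocalTorsion.localTorsion_eq_zero_of_nonsplit W p hp3 hmult hns)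

/-! ## §2 Split multiplicative `p ≥ 3`, cyclotomic tower: the Tate line and the mover `χ_p(τ) = −1` -/

omit [W.IsGloballyMinimal] in
/-- **Split multiplicative `p ≥ 3`, `κ` cyclotomic: `W(ℚ̄)[p^∞]^{D_v ⊓ ker κ}` is finite** (`LocalTowerTorsionFiniteAt W p κ v`)
at the place `v` of `ℚ` above `p`. Ingredients (all tree theorems): Tate's uniformisation `Φ` of `W` at `v` with period `q`,
the Tate line `C = ι⁻¹Φ(μ)` (`#C[p] ≤ p`, points of every order `p^k`), trivial action of `D_v` on `E[p^∞]/C`,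
finiteness of `E[p^∞]^{D_v} ↪ E(ℚ_v)[p^∞]`, and the mover `τ ∈ I_{ℚ_v}` with `χ_p(τ) = −1`: `res τ ∈ D_v ⊓ ker κ`
(`−1 ∈ μ(ℤ_p)`) acts on a point of `C` of order `p` as `−1 ≠ 1` (`p` odd); then `CtlLoc.localTowerTorsionFiniteAt_of_trivQuotLine`.
[cite: GreenbergLNM1716, §3 Lemma 3.3 (proof, p. 87) and PDF pp. 90–92] [cite: GreenbergVatsal2000, §2 pp. 14–15]
[cite: SilvermanATAEC1994, Ch. V Thm. 3.1 (c),(d) and Thm. 5.3] [cite: SerreLocalFields1979, Ch. IV §4 Prop. 17] -/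
theorem localTowerTorsionFiniteAt_of_split_of_isCyclotomic (hp3 : 3 ≤ p)
    (hsplit : W.HasSplitMultiplicativeReductionAtPrime p) (κ : ZpExtension ℚ p) (hκ : κ.IsCyclotomic)
    (v : HeightOneSpectrum (𝓞 ℚ)) (hv : ((Rat.HeightOneSpectrum.primesEquiv v : Nat.Primes) : ℕ) = p) :
    LocalTowerTorsionFiniteAt W p κ v := by
  have hpP : p.Prime := hp.out
  have hp2 : p ≠ 2 := by omega
  -- place-indexed split multiplicative reduction at `v`
  have hsplitv : W.HasSplitMultiplicativeReductionAt v := by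
    subst hv
    exact (W.hasSplitMultiplicativeReductionAtPrime_iff_hasSplitMultiplicativeReductionAt v).1 hsplit
  -- Tate's uniformisation at `v` (split: `Γ_{ℚ_v}`-equivariant)
  obtain ⟨q, Φ, hq0, hq1, hsurj, hkeriff, hΦσ, -⟩ :=
    TateCurve.Silverman1994_thmV53_tateUniformisation_holds W v hsplitv
  have hker : ∀ u : (AlgebraicClosure (v.adicCompletion ℚ))ˣ, Φ (Additive.ofMul u) = 0 →
      ∃ a : ℤ, (u : AlgebraicClosure (v.adicCompletion ℚ)) =
        algebraMap (v.adicCompletion ℚ) (AlgebraicClosure (v.adicCompletion ℚ)) q ^ a :=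
    fun u h ↦ (hkeriff u).1 h
  -- the sign convention of the twisted API with `t = 1` (no twist)
  have hΨσ : ∀ (σ : absoluteGaloisGroup (v.adicCompletion ℚ))
      (u : (AlgebraicClosure (v.adicCompletion ℚ))ˣ),
      σ • Φ (Additive.ofMul u) =
        (if Field.absoluteGaloisGroup.toAlgEquiv (v.adicCompletion ℚ) σ (1 : AlgebraicClosure
            (v.adicCompletion ℚ)) = 1 then (1 : ℤ) else -1) •
        Φ (Additive.ofMul (Units.map
          (Field.absoluteGaloisGroup.toAlgEquiv (v.adicCompletion ℚ) σ :
            AlgebraicClosure (v.adicCompletion ℚ) →* AlgebraicClosure (v.adicCompletion ℚ)) u)) := by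
    intro σ u
    have h1 : Field.absoluteGaloisGroup.toAlgEquiv (v.adicCompletion ℚ) σ
        (1 : AlgebraicClosure (v.adicCompletion ℚ)) = 1 := map_one _
    rw [if_pos h1, one_zsmul]
    exact hΦσ σ u
  set C := (tateDatum W p Φ (sign_disj W Φ 1 hΨσ)).plus with hC
  -- the numeric clauses of the Tate line
  obtain ⟨hC1, hCord⟩ := tateDatum_lineClauses W p Φ 1 hΨσ hq0 hq1 hker
  -- `E[p^∞]^{D_v}` is finite (`↪ E(ℚ_v)[p^∞]`)
  haveI := X12.O11.finite_primaryComponent_point_adicCompletion W p v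
  obtain ⟨hfinD, -⟩ := X11b.AcSelmer.natCard_fixedPoints_decomp_le_natCard_primaryComponent W p v
  haveI := hfinD
  refine CtlLoc.localTowerTorsionFiniteAt_of_trivQuotLine W p κ v C hC1
    (CtlLoc.tateDatum_smul_sub_mem_of_equivariant W p Φ _ hsurj hker hΦσ) ?_
  -- the mover: `τ ∈ I_{ℚ_v}` with `χ_p(τ) = -1`
  have hv' : (Rat.HeightOneSpectrum.primesEquiv v : ℕ) = p := hv
  obtain ⟨τ, -, hχ⟩ := adicCompletion_rat_exists_mem_absInertia_cyclotomicCharacter_eq (p := p) (v := v) hv' (-1)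
  set g := absGaloisRestrict ℚ (v.adicCompletion ℚ) τ with hg
  have hgD : g ∈ decomp v := (mem_decomp_iff v g).2 ⟨τ, rfl⟩
  have hχg : GaloisRep.cyclotomicCharacter ℚ p g = -1 := by
    haveI : NeZero ((p : ℕ) : ℚ) := NeZero.charZero
    rw [hg, cyclotomicCharacter_absGaloisRestrict ℚ (v.adicCompletion ℚ) p τ, hχ]
  have hgK : g ∈ κ.kerSubgroup := by
    have hdef : κ.kerSubgroup = (CommGroup.torsion ℤ_[p]ˣ).comap
        (GaloisRep.cyclotomicCharacter ℚ p).toMonoidHom := hκ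
    rw [hdef, Subgroup.mem_comap]
    change GaloisRep.cyclotomicCharacter ℚ p g ∈ CommGroup.torsion ℤ_[p]ˣ
    rw [CommGroup.mem_torsion, hχg]
    exact isOfFinOrder_iff_pow_eq_one.2 ⟨2, two_pos, by rw [neg_one_sq]⟩
  refine ⟨g, Subgroup.mem_inf.mpr ⟨hgD, hgK⟩, ?_⟩
  -- a point `c ∈ C` of order `p` is moved: `g • c = -c ≠ c`
  obtain ⟨c, hcC, hcord⟩ := hCord 1
  have hpc : p ^ 1 • c = 0 := by rw [← hcord]; exact addOrderOf_nsmul_eq_zero c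
  refine ⟨c, hcC, fun hfix ↦ ?_⟩
  have hact := smul_eq_sign_mul_cyclotomic_smul_of_mem_tateDatum W p Φ 1 hΨσ hq0 hq1 hker τ 1 c hcC hpc
  have h1 : Field.absoluteGaloisGroup.toAlgEquiv (v.adicCompletion ℚ) τ
      (1 : AlgebraicClosure (v.adicCompletion ℚ)) = 1 := map_one _
  rw [if_pos h1, one_mul, hχ] at hact
  -- `n = ((-1 : ℤ_p) mod p).val`, so `p ∣ n + 1` and `n • c = -c`
  set n : ℕ := (PadicInt.toZModPow 1 (((-1 : ℤ_[p]ˣ) : ℤ_[p]))).val with hn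
  have hn1 : ((n + 1 : ℕ) : ZMod (p ^ 1)) = 0 := by
    rw [Nat.cast_add, hn, ZMod.natCast_zmod_val, Units.val_neg, Units.val_one, map_neg, map_one,
      Nat.cast_one, neg_add_cancel]
  have hdvd : p ^ 1 ∣ n + 1 := (ZMod.natCast_eq_zero_iff _ _).1 hn1
  obtain ⟨m, hm⟩ := hdvd
  have hnc : ((n : ℤ)) • c = -c := by
    have h0 : (n + 1) • c = 0 := by rw [hm, mul_nsmul, hpc, nsmul_zero]
    rw [natCast_zsmul, eq_neg_iff_add_eq_zero, ← succ_nsmul, h0]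
  change g • c = c at hfix
  rw [hg, hact, hnc] at hfix
  -- `-c = c` forces `2 • c = 0`, impossible for a point of odd order `p`
  have h2c : 2 • c = 0 := by
    rw [two_nsmul]
    nth_rewrite 1 [← hfix]
    exact neg_add_cancel c
  have hdvd2 : addOrderOf c ∣ 2 := addOrderOf_dvd_of_nsmul_eq_zero h2c
  rw [hcord, pow_one] at hdvd2
  have hle : p ≤ 2 := Nat.le_of_dvd two_pos hdvd2
  omega

/-! ## §3 The `hfin` shape at a split prime, and the assembly at every multiplicative `p ≥ 3` -/

omit [W.IsGloballyMinimal] in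
/-- **Split multiplicative `p ≥ 3`, `κ` cyclotomic: `(W(ℚ̄)[p^∞])^{ker κ ⊓ D_v}` is FINITE** — the `hfin` binder of
`Kato2004.exists_iwasawaH2Data_fineSelmerDual_embedding` VERBATIM (the subgroup `ker κ ⊓ D_v` written in either order).
[cite: Kato2004Asterisque, §12.2 (12.2.3) (p. 220) and Thm. 12.5 (3) with (12.5.1) (p. 222)] [cite: GreenbergLNM1716, §3 PDF pp. 90–92] -/
theorem finite_fixedPoints_kerSubgroup_inf_decomp_of_split (hp3 : 3 ≤ p)
    (hsplit : W.HasSplitMultiplicativeReductionAtPrime p) (κ : ZpExtension ℚ p) (hκ : κ.IsCyclotomic)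
    (v : HeightOneSpectrum (𝓞 ℚ)) (hv : ((Rat.HeightOneSpectrum.primesEquiv v : Nat.Primes) : ℕ) = p) :
    Finite (FixedPoints.addSubgroup ↥(κ.kerSubgroup ⊓ decomp v) (W.geomPrimaryTorsion p)) := by
  have h := localTowerTorsionFiniteAt_of_split_of_isCyclotomic W p hp3 hsplit κ hκ v hv
  rw [LocalTowerTorsionFiniteAt, inf_comm] at h
  exact h.to_subtype

/-- **R-fin. Multiplicative `p ≥ 3` (split or non-split), `κ` cyclotomic: `W(ℚ_{p,∞})[p^∞] = (W(ℚ̄)[p^∞])^{ker κ ⊓ D_v}` is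
FINITE** — the `hfin` hypothesis of Kato's `𝐇²_Γ ⊇ X₀` comparison (`Kato2004.exists_iwasawaH2Data_fineSelmerDual_embedding`),
of its count sequel, of the typed length inequality F1′ (Kato Thm. 12.5 (4), fine-Selmer form) and of
`ErratumRoadFiveKatoFframeFineDescentRankOne.…_of_embedding_fact` (P1′), DISCHARGED on the whole regime of S1Λ
(`p ≥ 5`, `p ∥ N`). Kato's (12.5.1)-guard: at a multiplicative odd `p` the `Δ`-trivial local term `𝐇²_{Γ,loc}(T_pW)` is finite.
[cite: Kato2004Asterisque, Thm. 12.5 (3)–(4) with (12.5.1) (p. 222)] [cite: GreenbergLNM1716, §3 Lemma 3.3 and PDF pp. 90–92]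
[cite: JetchevSkinnerWan2017, §3.3 Prop. 3.3.4 Case 3(b)] -/
theorem finite_fixedPoints_kerSubgroup_inf_decomp_of_multiplicative (hp3 : 3 ≤ p)
    (hmult : W.HasMultiplicativeReductionAtPrime p) (κ : ZpExtension ℚ p) (hκ : κ.IsCyclotomic)
    (v : HeightOneSpectrum (𝓞 ℚ)) (hv : ((Rat.HeightOneSpectrum.primesEquiv v : Nat.Primes) : ℕ) = p) :
    Finite (FixedPoints.addSubgroup ↥(κ.kerSubgroup ⊓ decomp v) (W.geomPrimaryTorsion p)) := by
  by_cases hsplit : W.HasSplitMultiplicativeReductionAtPrime p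
  · exact finite_fixedPoints_kerSubgroup_inf_decomp_of_split W p hp3 hsplit κ hκ v hv
  · exact finite_fixedPoints_kerSubgroup_inf_decomp_of_nonsplit W p hp3 hmult hsplit κ v hv

/-- **R-fin at the place `primePlace p`** (the spelling of `Kato2004.LocPKummerLog` / `ExactFineControl`): multiplicative
`p ≥ 3`, `κ` cyclotomic. [cite: Kato2004Asterisque, Thm. 12.5 (3)–(4) with (12.5.1) (p. 222)] -/
theorem finite_fixedPoints_kerSubgroup_inf_decomp_primePlace_of_multiplicative (hp3 : 3 ≤ p)
    (hmult : W.HasMultiplicativeReductionAtPrime p) (κ : ZpExtension ℚ p) (hκ : κ.IsCyclotomic) :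
    Finite (FixedPoints.addSubgroup ↥(κ.kerSubgroup ⊓ decomp (Kato2004.primePlace p)) (W.geomPrimaryTorsion p)) :=
  finite_fixedPoints_kerSubgroup_inf_decomp_of_multiplicative W p hp3 hmult κ hκ (Kato2004.primePlace p)
    (Kato2004.coe_primesEquiv_primePlace p)

end Summit.BirchSwinnertonDyer.BirchSwinnertonDyer.Theorems.ErratumRoadFiveKatoFframeLocalTowerTorsionFiniteMult

end
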